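import Mathlib
import HarnessLib

/-!
# Venture HSemireg — the three SIGNED PURE-WEIL unit-graph designs R_re, m_H, T32 of the g = 8 family-B census at n = 4 (row B20-3):
# all 79 visible moments vanish (filler-free exactness, q = 0), the Weil moment m̂(+,+,+,+) is 128 ∕ 64 ∕ 32 ≠ 0, supports 128 ∕ 64 ∕ 32
# — kernel `decide` certificates in ℤ[i]

HONEST FRAMING. Part of the Lean index of the computation cell `pub-hsemireg` (Sunday typer seat p9, § g = 8; family B row **B20-3** of
`target-g8/CENSUS.md` v1.274 `7744dc4867915f69`: «SIGNED pure-Weil unit-graph cycles: R_re (support 128), m_H (64), T32 (32); ladder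
supports 2 / 4 / 16 at n = 1 / 2 / 3; bounds s(3) ∈ [8,16], s(4) ∈ [16,32] | A₀ (and E_i^{2n}, n ≤ 3) | cycles with ℤ-coefficients (class
witnesses, not objects) | EXACT PURE WEIL (q = 0) ×1 (R_re ×2 by t-22)»). FINITE GAUSSIAN-INTEGER ARITHMETIC ONLY: three explicit
functions `m : (ℤ∕4)⁴ → ℤ` (signed designs, by exponent vectors of the letters i^{x_k}), the 81 characters `x ↦ i^{ε·x}`
(`ε ∈ {0, ±1}⁴`), their moments and support counts. No abelian variety, graph Γ_D, cycle or class is constructed; the DICTIONARY — that a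
signed unit-graph design Σ m(x)[Γ_{D(x)}] is a class-exact PURE-WEIL cycle with ℤ-coefficients iff ALL its visible moments vanish
(t-20 §2.1 LEMMA W, filler-free form: «Without fillers a graph-only design forces q = 0») and that m̂(1,…,1) ≠ 0 is W-aliveness — is
TEXT OF RECORD, not a binder and not proved here; the class values [R_re] = 8Ω + 8Ω̄, 4Ω + 4Ω̄, 2Ω + 2Ω̄ are t-20 ∣ t-22 by machine and
are NOT re-derived (only the raw moments 128, 64, 32 are computed here); nothing here says that HC ∕ HC_CM ∕ HC_AV holds; no object is
certified (row B20-3: «class witnesses, not objects»); no Literature fact is declared.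

TEXT OF RECORD (quoted, not interpreted). Source: t-20, `target-g8/FAMILY-B-G8-t20.md` v1.25 `987a3ee140325c40`, §2.6: «Signed
pure-Weil designs (filler-free, q = 0): all 79 visible moments (ε ∈ {0,±1}⁴ ∖ {0, ±1⁴}) AND m̂(0) must vanish. R_re: m(x) = Re i^{−|x|}
on {|x| even} (64 − 64, support 128): EXACT, [R_re] = 8Ω + 8Ω̄ (= t-22's P, ×2). m_H: (−1)^{x₃+x₄} on H = {x₁+x₂ ≡ x₃+x₄ (4)}
(32 − 32, support 64; …): EXACT, 4Ω + 4Ω̄. T32 := m₂ ⊗ m₂ + (shift (+1,0) m₂) ⊗ (shift (−1,0) m₂), m₂(d,d) = (−1)^d the n = 2 scalar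
design (16 − 16, support 32): EXACT, 2Ω + 2Ω̄, Hamming histogram {2: 160, 3: 128, 4: 208}. … hence 8 ≤ s(3) ≤ 16, 16 ≤ s(4) ≤ 32.
(Signed designs are class witnesses — cycles with ℤ-coefficients — not census objects.)» §1 FRAME: «for K = ℚ(i) write D_k = i^{x_k},
x ∈ (ℤ/4)ⁿ, and m̂(ε) := Σ_x m(x) i^{ε·x} for ε ∈ {0,±1}ⁿ.»

WHAT THIS FILE PROVES (kernel `decide`, n = 4; `Letter = Fin 4 → Fin 4` = exponent vectors, `Eps = Fin 4 → Fin 3` = patterns ε with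
the code 0 ↦ ε_k = 0, 1 ↦ ε_k = +1, 2 ↦ ε_k = −1; `unitTab` = (1, i, −1, −i); `expo ε x = ε·x ∈ ℤ∕4`; `vchi ε x = i^{ε·x}`;
`vmoment m ε = m̂(ε)`; «visible» = ε ∉ {+1⁴, −1⁴}, written `ε ≠ plus → ε ≠ minus` (79 patterns, the zero pattern included: m̂(0) = Σ m = 0 is «q = 0»)).
`card_visible` (= 79); the designs `Rre`, `mH`, `T32` exactly as printed (T32 with the tensor/shift convention spelled out in its
docstring); for each: **all 79 visible moments vanish**, **m̂(+,+,+,+) = 128 ∕ 64 ∕ 32** (so ≠ 0, and m̂(−,−,−,−) is the same integer),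
**support = 128 ∕ 64 ∕ 32**, values in {0, ±1} with 64−64 ∕ 32−32 ∕ 16−16 signs (`Rre_certificate`, `mH_certificate`,
`T32_certificate`, `*_signs`), and T32's graph–graph Hamming histogram {2: 160, 3: 128, 4: 208} over unordered support pairs
(`T32_hamming`). So s(4) ≤ 32 by an explicit witness in the kernel.

WHAT IS NOT HERE. LEMMA W ∕ the class values in ℚh⁴ ⊕ W_K (machine, t-20 ∣ t-22); LEMMA S and the lower bounds s(3) ≥ 8, s(4) ≥ 16;
the n ≤ 3 rungs of the signed ladder; anything about sheaves, fillers or semiregularity. The sister files `WalshParityN4.lean` ∕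
`WalshParityGeneral.lean` treat the 2ⁿ FULL-sign moments (ε ∈ {±1}ⁿ) of class-completable designs; this file needs the 3ⁿ patterns with
zeros and keeps its own small vocabulary (namespace `SignedWeilDesign`) rather than importing theirs.
-/

namespace Summit.Ventures.HSemireg.SignedWeilDesign

open Finset

/-- Exponent vectors `x ∈ (ℤ∕4)⁴`: the letter of factor `k` is `i^{x_k}`. [definition of this file] -/
abbrev Letter := Fin 4 → Fin 4

/-- Moment patterns `ε ∈ {0, ±1}⁴`, coded `0 ↦ 0`, `1 ↦ +1`, `2 ↦ −1`. [definition of this file] -/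
abbrev Eps := Fin 4 → Fin 3

/-- The table of fourth roots of unity `(i^0, i^1, i^2, i^3) = (1, i, −1, −i)` in `ℤ[i]`. [definition of this file] -/
def unitTab : Fin 4 → GaussianInt := ![1, ⟨0, 1⟩, -1, -⟨0, 1⟩]

/-- The coefficient `ε_k ∈ ℤ∕4` of a pattern code: `0 ↦ 0`, `+1 ↦ 1`, `−1 ↦ 3`. [definition of this file] -/
def coef : Fin 3 → Fin 4 := ![0, 1, 3]

/-- The exponent `ε·x = Σ_k ε_k x_k ∈ ℤ∕4`. [definition of this file] -/
def expo (ε : Eps) (x : Letter) : Fin 4 := ∑ k, coef (ε k) * x k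

/-- The character value `i^{ε·x}`. [definition of this file] -/
def vchi (ε : Eps) (x : Letter) : GaussianInt := unitTab (expo ε x)

/-- The moment `m̂(ε) = Σ_x m(x)·i^{ε·x}` of an integer (signed) design (t-20 §1). [definition of this file] -/
def vmoment (m : Letter → ℤ) (ε : Eps) : GaussianInt := ∑ x, (m x : GaussianInt) * vchi ε x

/-- The all-plus pattern `(+1, +1, +1, +1)` (the Weil moment `m̂(1,…,1)`, coefficient of Ω). [definition of this file] -/
def plus : Eps := fun _ => 1

/-- The all-minus pattern `(−1, −1, −1, −1)` (coefficient of Ω̄). [definition of this file] -/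
def minus : Eps := fun _ => 2

/-- A pattern is VISIBLE when it is neither all-plus nor all-minus (written `ε ≠ plus → ε ≠ minus → …` below): there are exactly
79 = 81 − 2 visible patterns — the moments that must vanish for a filler-free (q = 0) class-exact pure-Weil signed design, the zero
pattern (m̂(0) = Σ_x m(x), «q = 0») included («all 79 visible moments»). -/
theorem card_visible : (Finset.univ.filter (fun ε : Eps => ε ≠ plus ∧ ε ≠ minus)).card = 79 := by decide +kernel

/-- The support of a design. [definition of this file] -/
def supp (m : Letter → ℤ) : Finset Letter := Finset.univ.filter (fun x => m x ≠ 0)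

/-- `|x| mod 4`. [definition of this file] -/
def wt4 (x : Letter) : Fin 4 := ∑ k, x k

/-- `(−1)^d` for `d ∈ ℤ∕4`. [definition of this file] -/
def sgn4 (d : Fin 4) : ℤ := if d = 0 ∨ d = 2 then 1 else -1

/-! ## §1 R_re (support 128) -/

/-- **R_re**: `m(x) = Re i^{−|x|}` on `{|x| even}`, i.e. `+1` if `|x| ≡ 0`, `−1` if `|x| ≡ 2 (mod 4)`, `0` if `|x|` is odd.
[definition of this file] -/
def Rre : Letter → ℤ := fun x => if wt4 x = 0 then 1 else if wt4 x = 2 then -1 else 0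

/-- **CERTIFICATE FOR R_re:** all 79 visible moments vanish, `m̂(+,+,+,+) = m̂(−,−,−,−) = 128`, support 128. -/
theorem Rre_certificate :
    (∀ ε : Eps, ε ≠ plus → ε ≠ minus → vmoment Rre ε = 0) ∧ vmoment Rre plus = 128 ∧ vmoment Rre minus = 128 ∧ (supp Rre).card = 128 := by
  refine ⟨?_, by decide +kernel, by decide +kernel, by decide +kernel⟩
  decide +kernel

/-- R_re takes the value `+1` on 64 letters and `−1` on 64 letters («64 − 64»). -/
theorem Rre_signs : (Finset.univ.filter (fun x : Letter => Rre x = 1)).card = 64 ∧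
    (Finset.univ.filter (fun x : Letter => Rre x = -1)).card = 64 := by
  constructor <;> decide +kernel

/-! ## §2 m_H (support 64) -/

/-- **m_H**: `(−1)^{x₃+x₄}` on the subgroup `H = {x₁ + x₂ ≡ x₃ + x₄ (mod 4)}`, `0` off `H` (factors numbered 1..4 in the text, 0..3
here). [definition of this file] -/
def mH : Letter → ℤ := fun x => if x 0 + x 1 = x 2 + x 3 then sgn4 (x 2 + x 3) else 0

/-- **CERTIFICATE FOR m_H:** all 79 visible moments vanish, `m̂(+,+,+,+) = m̂(−,−,−,−) = 64`, support 64. -/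
theorem mH_certificate :
    (∀ ε : Eps, ε ≠ plus → ε ≠ minus → vmoment mH ε = 0) ∧ vmoment mH plus = 64 ∧ vmoment mH minus = 64 ∧ (supp mH).card = 64 := by
  refine ⟨?_, by decide +kernel, by decide +kernel, by decide +kernel⟩
  decide +kernel

/-- m_H takes the value `+1` on 32 letters and `−1` on 32 letters («32 − 32»). -/
theorem mH_signs : (Finset.univ.filter (fun x : Letter => mH x = 1)).card = 32 ∧
    (Finset.univ.filter (fun x : Letter => mH x = -1)).card = 32 := by
  constructor <;> decide +kernel

/-! ## §3 T32 (support 32) -/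

/-- **T32** `:= m₂ ⊗ m₂ + (shift (+1,0) m₂) ⊗ (shift (−1,0) m₂)` with `m₂(d,d) = (−1)^d` the n = 2 scalar design: on factors (0,1) × (2,3),
`T32(x) = [x₀ = x₁][x₂ = x₃]·(−1)^{x₀ + x₂} + [x₀ = x₁ + 1][x₂ = x₃ − 1]·(−1)^{x₁ + x₃}` (the shift moves the FIRST coordinate of the
diagonal pair and keeps the sign of the unshifted one; the two summands have disjoint supports of 16 letters each). [definition of this file] -/
def T32 : Letter → ℤ := fun x =>
  (if x 0 = x 1 ∧ x 2 = x 3 then sgn4 (x 0) * sgn4 (x 2) else 0) +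
  (if x 0 = x 1 + 1 ∧ x 2 + 1 = x 3 then sgn4 (x 1) * sgn4 (x 3) else 0)

/-- **CERTIFICATE FOR T32:** all 79 visible moments vanish, `m̂(+,+,+,+) = m̂(−,−,−,−) = 32`, support 32 — so the minimal filler-free
signed support at n = 4 satisfies `s(4) ≤ 32` by an explicit kernel witness. -/
theorem T32_certificate :
    (∀ ε : Eps, ε ≠ plus → ε ≠ minus → vmoment T32 ε = 0) ∧ vmoment T32 plus = 32 ∧ vmoment T32 minus = 32 ∧ (supp T32).card = 32 := by
  refine ⟨?_, by decide +kernel, by decide +kernel, by decide +kernel⟩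
  decide +kernel

/-- T32 takes the value `+1` on 16 letters and `−1` on 16 letters («16 − 16»), and no other non-zero value. -/
theorem T32_signs : (Finset.univ.filter (fun x : Letter => T32 x = 1)).card = 16 ∧
    (Finset.univ.filter (fun x : Letter => T32 x = -1)).card = 16 ∧
    (∀ x : Letter, T32 x = 0 ∨ T32 x = 1 ∨ T32 x = -1) := by
  refine ⟨by decide +kernel, by decide +kernel, ?_⟩
  decide +kernel

/-- The Hamming distance of two exponent vectors (number of factors where the letters differ). [definition of this file] -/
def hamming (x y : Letter) : ℕ := (Finset.univ.filter (fun k => x k ≠ y k)).card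

/-- **T32's GRAPH–GRAPH HAMMING HISTOGRAM** over the 496 unordered pairs of distinct support letters: 160 pairs at distance 2, 128 at
distance 3, 208 at distance 4, none at distance 1 («Hamming histogram {2: 160, 3: 128, 4: 208}»). Counted over ORDERED pairs (twice
each). -/
theorem T32_hamming :
    (((supp T32) ×ˢ (supp T32)).filter (fun p => hamming p.1 p.2 = 1)).card = 0 ∧
    (((supp T32) ×ˢ (supp T32)).filter (fun p => hamming p.1 p.2 = 2)).card = 2 * 160 ∧
    (((supp T32) ×ˢ (supp T32)).filter (fun p => hamming p.1 p.2 = 3)).card = 2 * 128 ∧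
    (((supp T32) ×ˢ (supp T32)).filter (fun p => hamming p.1 p.2 = 4)).card = 2 * 208 := by
  refine ⟨by decide +kernel, by decide +kernel, by decide +kernel, by decide +kernel⟩

end Summit.Ventures.HSemireg.SignedWeilDesign
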